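import Literature.Barriers.CriticalPhenomena.LaceExpansionHaraLemma41
import Literature.Barriers.CriticalPhenomena.LaceExpansionXSpaceNormsTorus
import Literature.Barriers.CriticalPhenomena.LaceExpansionXSpaceNormsLeibniz
import HarnessLib

/-!
# Increment bounds for `∂_l^m Ĝ` along coordinate lines at `p_c` (Hara 2008, Lemma 4.1 and
# §4.1.4), uniformly in the line

Barrier catalogue `Literature/Barriers/CriticalPhenomena/` (D-0021), fourth support file for the
discharge of `Hara2008_lemma17Pc` (`LaceExpansionXSpaceNorms.lean`: Hara 2008, Lemma 1.7 —
Lemma 1.9 in the journal). The abstract slice calculus of `LaceExpansionXSpaceNormsLeibniz.lean`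
(`HaraNorms.SliceHyp`) is INSTANTIATED for the objects of the tree's Lemma 4.1 pipeline
(`LaceExpansionHaraLemma41.lean`): `Ĝ = kspaceTwoPoint J g` with `g = δ₀ + Π` (`laceSource Φ`),
`J = 2dp_c D ⋆ g` (`laceKernel p_c Φ`), under `IsLaceCoefficientPc d Φ` and the moment
`Σ_x (1+|x|)^M |Π(x)| < ∞`, `M ≥ 2`. Along the line `s ↦ k[l ↦ s]`:

* `φ_g = ĝ` and `φ_D = (2dp_c D)^ = 2p_c Σ_j cos` — the latter realised as the transform of the
  finitely supported `stepKernel d p_c = laceKernel p_c 0`, so that `Ĵ = φ_D φ_g`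
  (`latticeFT_laceKernel_eq_mul`) and both factors are slices of lattice transforms
  (`contDiff_latticeFT_update`, `iteratedDeriv_latticeFT_update` of
  `LaceExpansionLatticeFTHigherDeriv.lean`); the abstract distance is `r = ω/R`, `ω` the distance
  to `2πℤ^d` (`HaraNorms.omega`), `R = π√d + 1`;
* `sliceHyp_kspaceTwoPoint` — on every GOOD line (one avoiding `2πℤ^d`, `HaraNorms.GoodLine`)
  the hypotheses `SliceHyp M 1 c C` hold with `c, C` INDEPENDENT of the line (infrared bound
  transferred off the cube by periodicity; the evenness bounds `‖∂ĝ‖, ‖∂D̂‖ ≤ K₂ ω`);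
* consequences, uniformly in the line: `‖∂_l^m Ĝ‖ ≤ B ω^{-(2+m)}` off `2πℤ^d`
  (`exists_norm_iteratedDeriv_twoPointSlice_le`; on the cube this is the tree's
  `IsLaceCoefficientPc.exists_norm_sliceDeriv_le`, here for all `k` through `ω`), the increments
  `‖∂_l^m Ĝ(s+u) - ∂_l^m Ĝ(s)‖ ≤ B u ω₀^{-(3+m)}` for `m < M`
  (`exists_norm_incr_twoPointSlice_le`) and, from `Σ_x |x|^{M+θ}|Π(x)| < ∞`, the top-order
  Hölder increment `≤ B (u^θ ω₀^{-(2+M)} + u ω₀^{-(3+M)})` (`exists_norm_incr_twoPointSlice_top_le`)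
  — the input for `Ḡ^{(α)}`, `⌊φ⌋ < α ≤ φ` (§4.1.4).

## References

* T. Hara, Ann. Probab. 36 (2008) 530–593 (arXiv:math-ph/0504021; equation numbers of the
  journal version): Prop. 1.2 (`Ĵ = 2dpD̂ĝ`, the infrared bound), Lemma 4.1 ((4.6)–(4.7)) and
  §4.2, §4.1.4.
-/

noncomputable section

namespace Literature.Barriers.CriticalPhenomena.HaraNorms

open Set Filter Literature.Probability.LatticeModels Literature.Probability.Percolation
open scoped Topology

variable {d : ℕ}

/-! ### The trigonometric factor as the transform of the step kernel -/

/-- The step kernel `2dp D = p Σ_j (δ_{e_j} + δ_{-e_j})`, i.e. `laceKernel p 0`; its transform is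
`2p Σ_j cos k_j`. [cite: Hara2008, Prop. 1.2 (D̂(k) = d⁻¹ Σ_j cos k_j)] -/
def stepKernel (d : ℕ) (p : ℝ) : Site d → ℝ := laceKernel p (0 : Site d → ℝ)

/-- `laceSource 0 = δ₀`. [folklore] -/
theorem laceSource_zero (x : Site d) : laceSource (0 : Site d → ℝ) x = if x = 0 then 1 else 0 := by
  simp [laceSource]

/-- `Σ |laceSource 0| < ∞`. [folklore] -/
theorem summable_abs_laceSource_zero : Summable fun x : Site d => |laceSource (0 : Site d → ℝ) x| :=
  summable_abs_laceSource (by simp [summable_zero])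

/-- `δ̂₀ = 1`. [folklore] -/
theorem latticeFT_laceSource_zero (k : Fin d → ℝ) : latticeFT (laceSource (0 : Site d → ℝ)) k = 1 := by
  unfold latticeFT
  rw [tsum_eq_single 0]
  · simp [laceSource_zero]
  · intro x hx
    simp [laceSource_zero, hx]

/-- **The transform of the step kernel is the trigonometric factor**:
`(stepKernel p)^(k) = 2p Σ_j cos k_j`. [cite: Hara2008, Prop. 1.2 (Ĵ_p = 2dp D̂ ĝ, D̂ = d⁻¹Σcos)] -/
theorem latticeFT_stepKernel (p : ℝ) (k : Fin d → ℝ) :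
    latticeFT (stepKernel d p) k = ((2 * p * ∑ i, Real.cos (k i) : ℝ) : ℂ) := by
  rw [stepKernel, latticeFT_laceKernel summable_abs_laceSource_zero, latticeFT_laceSource_zero, mul_one]

/-- **`Ĵ = D̂-factor × ĝ`**: `Ĵ(k) = (stepKernel p)^(k) ĝ(k)`. [cite: Hara2008, Prop. 1.2 (Ĵ_p = 2dp D̂{1 + Π̂_p})] -/
theorem latticeFT_laceKernel_eq_mul {Φ : Site d → ℝ} (hΦ : Summable fun x => |Φ x|) (p : ℝ) (k : Fin d → ℝ) :
    latticeFT (laceKernel p Φ) k = latticeFT (stepKernel d p) k * latticeFT (laceSource Φ) k := by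
  rw [latticeFT_laceKernel (summable_abs_laceSource hΦ), latticeFT_stepKernel]

/-- All moments of the step kernel are finite. [folklore] -/
theorem summable_moment_stepKernel (n : ℕ) (p : ℝ) :
    Summable fun x : Site d => (1 + euclidNorm x) ^ n * |stepKernel d p x| :=
  summable_moment_laceKernel (by simp [summable_zero]) p

/-- The step kernel is `ℤ^d`-symmetric. [folklore] -/
theorem isZdSymmetric_stepKernel (p : ℝ) : IsZdSymmetric (stepKernel d p) :=
  isZdSymmetric_laceKernel (fun _ _ _ => rfl) p

/-! ### The slice data of `Ĝ = kspaceTwoPoint J g` at `p_c` -/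

/-- The slice `s ↦ Ĝ(k[l ↦ s])` of the `k`-space two-point function. [cite: Hara2008, §4.1.1 (∂_j applied to Ĝ)] -/
def twoPointSlice (Φ : Site d → ℝ) (k : Fin d → ℝ) (l : Fin d) : ℝ → ℂ :=
  fun s => kspaceTwoPoint (laceKernel (criticalProbI d) Φ) (laceSource Φ) (Function.update k l s)

/-- `φ_g`: the slice of `ĝ`. [cite: Hara2008, Prop. 1.2 (ĝ_p = 1 + Π̂_p)] -/
def sourceSlice (Φ : Site d → ℝ) (k : Fin d → ℝ) (l : Fin d) : ℝ → ℂ :=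
  fun s => latticeFT (laceSource Φ) (Function.update k l s)

/-- `φ_D`: the slice of `(2dp_c D)^ = 2p_c Σ cos`. [cite: Hara2008, Prop. 1.2 (2dp D̂)] -/
def stepSlice (d : ℕ) (k : Fin d → ℝ) (l : Fin d) : ℝ → ℂ :=
  fun s => latticeFT (stepKernel d (criticalProbI d)) (Function.update k l s)

/-- **`Ĝ` along a line is the abstract `sliceG`** of `φ_g` and `φ_D`. [cite: Hara2008, (1.9), Prop. 1.2] -/
theorem twoPointSlice_eq_sliceG {Φ : Site d → ℝ} (hΦ : Summable fun x => |Φ x|) (k : Fin d → ℝ) (l : Fin d) :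
    twoPointSlice Φ k l = sliceG (sourceSlice Φ k l) (stepSlice d k l) := by
  funext s
  simp only [twoPointSlice, kspaceTwoPoint, sliceG, sliceA, sourceSlice, stepSlice, latticeFT_laceKernel_eq_mul hΦ]

/-- `∂_l^m Ĝ(k) = (twoPointSlice)^{(m)}(k_l)`. [folklore] -/
theorem sliceDeriv_eq_iteratedDeriv_twoPointSlice (Φ : Site d → ℝ) (l : Fin d) (m : ℕ) (k : Fin d → ℝ) :
    sliceDeriv (kspaceTwoPoint (laceKernel (criticalProbI d) Φ) (laceSource Φ)) l m k =
      iteratedDeriv m (twoPointSlice Φ k l) (k l) := rfl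

/-- The slice through `k[l ↦ s₀]` is the slice through `k`. [folklore] -/
theorem twoPointSlice_update (Φ : Site d → ℝ) (k : Fin d → ℝ) (l : Fin d) (s₀ : ℝ) :
    twoPointSlice Φ (Function.update k l s₀) l = twoPointSlice Φ k l := by
  funext s; simp [twoPointSlice]

/-- A line `s ↦ k[l ↦ s]` is GOOD if it avoids `2πℤ^d`: some other coordinate of `k` is not in
`2πℤ`. [folklore] -/
def GoodLine (k : Fin d → ℝ) (l : Fin d) : Prop := ∃ i, i ≠ l ∧ wrap (k i) ≠ 0

/-- On a good line `ω(k[l ↦ s]) ≥ |wrap (k_i)| > 0` uniformly in `s`. [folklore] -/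
theorem GoodLine.omega_pos {k : Fin d → ℝ} {l : Fin d} (h : GoodLine k l) (s : ℝ) :
    0 < omega (Function.update k l s) := by
  obtain ⟨i, hil, hi⟩ := h
  have h1 := abs_wrap_le_omega (Function.update k l s) i
  rw [Function.update_of_ne hil] at h1
  exact lt_of_lt_of_le (abs_pos.2 hi) h1

/-- The normalising radius `R = π√d + 1`, so that `ω/R ≤ 1`. [folklore] -/
def Rnorm (d : ℕ) : ℝ := Real.pi * Real.sqrt d + 1

/-- `R > 0`. [folklore] -/
theorem Rnorm_pos (d : ℕ) : 0 < Rnorm d := by rw [Rnorm]; positivity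

/-- `1 ≤ R`. [folklore] -/
theorem one_le_Rnorm (d : ℕ) : 1 ≤ Rnorm d := by
  rw [Rnorm]; linarith [(by positivity : 0 ≤ Real.pi * Real.sqrt d)]

/-- `ω ≤ R`. [folklore] -/
theorem omega_le_Rnorm (q : Fin d → ℝ) : omega q ≤ Rnorm d := by
  rw [Rnorm]; linarith [omega_le q]

/-- The abstract distance of a line: `r(s) = ω(k[l ↦ s])/R`. [folklore] -/
def rline (k : Fin d → ℝ) (l : Fin d) : ℝ → ℝ := fun s => omega (Function.update k l s) / Rnorm d

/-! ### Verifying `SliceHyp` on every good line, with constants independent of the line -/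

section Instance

variable {Φ : Site d → ℝ} {M : ℕ}

/-- **The slice hypotheses at `p_c`**: under `IsLaceCoefficientPc d Φ`, `Σ_x (1+|x|)^M|Π(x)| < ∞`
and `M ≥ 2`, there are `c > 0` and `C ≥ 1` such that on EVERY good line the pair
(`φ_g`, `φ_D`) with `r = ω/R` satisfies `SliceHyp M 1 c C` — orders of differentiability from
the moments (`contDiff_latticeFT_update`), the derivative bounds from `norm_latticeFTDn_le`, the
first-derivative bounds `≤ K₂ ω` from the evenness of `g` and `D`, and the infrared bound
`c₀|k|² ≤ |1 - Ĵ(k)|` transferred off the cube by periodicity.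
[cite: Hara2008, Prop. 1.2 and proof of Lemma 4.1 ((4.20)–(4.22))] -/
theorem sliceHyp_kspaceTwoPoint (h : IsLaceCoefficientPc d Φ) (hM2 : 2 ≤ M)
    (hmom : Summable fun x => (1 + euclidNorm x) ^ M * |Φ x|) :
    ∃ c C : ℝ, 0 < c ∧ 1 ≤ C ∧ ∀ (k : Fin d → ℝ) (l : Fin d), GoodLine k l →
      SliceHyp M 1 c C (sourceSlice Φ k l) (stepSlice d k l) (rline k l) := by
  -- moments
  have hg : Summable fun x => (1 + euclidNorm x) ^ M * |laceSource Φ x| := summable_moment_laceSource hmom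
  have hK : Summable fun x : Site d => (1 + euclidNorm x) ^ (M + 1) * |stepKernel d (criticalProbI d) x| :=
    summable_moment_stepKernel (M + 1) _
  have hg0 : Summable fun x => |laceSource Φ x| := summable_abs_of_moment hg
  have hK0 : Summable fun x : Site d => |stepKernel d (criticalProbI d) x| := summable_abs_of_moment hK
  have hg2 : Summable fun x => euclidNorm x ^ 2 * |laceSource Φ x| := summable_sq_mul_abs_of_moment hg hM2
  have hK2 : Summable fun x : Site d => euclidNorm x ^ 2 * |stepKernel d (criticalProbI d) x| :=
    summable_sq_mul_abs_of_moment hK (by omega)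
  have hgs : IsZdSymmetric (laceSource Φ) := isZdSymmetric_laceSource h.symm
  have hKs : IsZdSymmetric (stepKernel d (criticalProbI d)) := isZdSymmetric_stepKernel _
  -- constants
  obtain ⟨c₀, hc₀, hlow⟩ := h.exists_knorm_sq_le_norm
  set R := Rnorm d with hR
  have hRpos := Rnorm_pos d
  have hR1 := one_le_Rnorm d
  set Cg : ℝ := ∑' x, (1 + euclidNorm x) ^ M * |laceSource Φ x| with hCg
  set CK : ℝ := ∑' x : Site d, (1 + euclidNorm x) ^ (M + 1) * |stepKernel d (criticalProbI d) x| with hCK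
  set Kg : ℝ := ∑' x, euclidNorm x ^ 2 * |laceSource Φ x| with hKg
  set KK : ℝ := ∑' x : Site d, euclidNorm x ^ 2 * |stepKernel d (criticalProbI d) x| with hKK
  have hCg0 : 0 ≤ Cg := tsum_nonneg fun x => moment_term_nonneg M _ x
  have hCK0 : 0 ≤ CK := tsum_nonneg fun x => moment_term_nonneg (M + 1) _ x
  have hKg0 : 0 ≤ Kg := tsum_nonneg fun x => by positivity
  have hKK0 : 0 ≤ KK := tsum_nonneg fun x => by positivity
  set C : ℝ := 1 + Cg + CK + (Kg + KK) * R with hC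
  have hC1 : 1 ≤ C := by rw [hC]; nlinarith
  refine ⟨c₀ * R ^ 2, C, by positivity, hC1, fun k l hkl => ?_⟩
  -- pointwise facts along the line
  have hRne : R ≠ 0 := ne_of_gt hRpos
  have hr : ∀ s, rline k l s = omega (Function.update k l s) / R := fun s => rfl
  have hω : ∀ s, omega (Function.update k l s) = R * rline k l s := fun s => by
    rw [hr]; field_simp
  refine
    { one_le_kappa := le_rfl
      kappa_le_two := by norm_num
      c_pos := by positivity
      one_le_C := hC1
      contDiff_g := contDiff_latticeFT_update hg k l
      contDiff_D := by exact_mod_cast contDiff_latticeFT_update hK k l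
      r_pos := fun s => div_pos (hkl.omega_pos s) hRpos
      r_le_one := fun s => by
        rw [hr, div_le_one hRpos]; exact omega_le_Rnorm _
      lower := fun s => ?_
      g_bound := fun i hi s => ?_
      D_bound := fun i hi s => ?_
      g_one := fun _ s => ?_
      D_one := fun s => ?_ }
  · -- infrared bound off the cube
    have hq := hlow (red (Function.update k l s)) (red_mem_cube _)
    rw [latticeFT_red] at hq
    simp only [stepSlice, sourceSlice]
    rw [← latticeFT_laceKernel_eq_mul h.summable_abs]
    calc c₀ * R ^ 2 * rline k l s ^ 2 = c₀ * omega (Function.update k l s) ^ 2 := by rw [hω]; ring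
      _ = c₀ * knorm (red (Function.update k l s)) ^ 2 := rfl
      _ ≤ _ := hq
  · -- `‖φ_g^{(i)}‖ ≤ Cg ≤ C`
    unfold sourceSlice
    rw [iteratedDeriv_latticeFT_update hg k l i hi]
    calc ‖latticeFTDn (laceSource Φ) l i (Function.update k l s)‖ ≤ Cg := norm_latticeFTDn_le hg l hi _
      _ ≤ C := by rw [hC]; nlinarith
  · -- `‖φ_D^{(i)}‖ ≤ CK ≤ C`
    unfold stepSlice
    rw [iteratedDeriv_latticeFT_update hK k l i hi]
    calc ‖latticeFTDn (stepKernel d (criticalProbI d)) l i (Function.update k l s)‖ ≤ CK :=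
          norm_latticeFTDn_le hK l hi _
      _ ≤ C := by rw [hC]; nlinarith
  · -- `‖φ_g'‖ ≤ Kg ω = Kg R r ≤ C r`
    unfold sourceSlice
    rw [iteratedDeriv_latticeFT_update hg k l 1 (by omega), show (2 : ℝ) - 1 = 1 by norm_num, Real.rpow_one]
    calc ‖latticeFTDn (laceSource Φ) l 1 (Function.update k l s)‖ ≤ Kg * omega (Function.update k l s) :=
          norm_latticeFTDn_one_le_omega hgs hg0 hg2 l _
      _ = Kg * R * rline k l s := by rw [hω]; ring
      _ ≤ C * rline k l s := by
          have hr0 : 0 ≤ rline k l s := (div_pos (hkl.omega_pos s) hRpos).le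
          apply mul_le_mul_of_nonneg_right _ hr0
          rw [hC]; nlinarith
  · -- `‖φ_D'‖ ≤ KK ω ≤ C r`
    unfold stepSlice
    rw [iteratedDeriv_latticeFT_update hK k l 1 (by omega), show (2 : ℝ) - 1 = 1 by norm_num, Real.rpow_one]
    calc ‖latticeFTDn (stepKernel d (criticalProbI d)) l 1 (Function.update k l s)‖ ≤
        KK * omega (Function.update k l s) := norm_latticeFTDn_one_le_omega hKs hK0 hK2 l _
      _ = KK * R * rline k l s := by rw [hω]; ring
      _ ≤ C * rline k l s := by
          have hr0 : 0 ≤ rline k l s := (div_pos (hkl.omega_pos s) hRpos).le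
          apply mul_le_mul_of_nonneg_right _ hr0
          rw [hC]; nlinarith

/-- The real moment passes from `Π` to `g = δ₀ + Π` (`|x|^q δ₀ = 0` for `q > 0`). [folklore] -/
theorem summable_rpow_mul_abs_laceSource {q : ℝ} (hq : 0 < q)
    (hΦ : Summable fun x => euclidNorm x ^ q * |Φ x|) :
    Summable fun x => euclidNorm x ^ q * |laceSource Φ x| := by
  refine Summable.of_nonneg_of_le (fun x => mul_nonneg (Real.rpow_nonneg (euclidNorm_nonneg x) q) (abs_nonneg _))
    (fun x => ?_) hΦ
  by_cases hx : x = 0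
  · subst hx
    have h0 : euclidNorm (0 : Site d) = 0 := by simp [euclidNorm]
    rw [h0, Real.zero_rpow hq.ne', zero_mul, zero_mul]
  · rw [laceSource, if_neg hx, zero_add]

end Instance

/-! ### Consequences: derivative and increment bounds for `∂_l^m Ĝ`, uniformly in the line -/

section Consequences

variable {Φ : Site d → ℝ} {M : ℕ}

/-- `(ω/R)^{-a} = R^a ω^{-a}`. [folklore] -/
theorem div_Rnorm_rpow_neg (ω a : ℝ) (hω : 0 ≤ ω) : (ω / Rnorm d) ^ (-a) = Rnorm d ^ a * ω ^ (-a) := by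
  rw [Real.div_rpow hω (Rnorm_pos d).le, Real.rpow_neg (Rnorm_pos d).le, div_inv_eq_mul, mul_comm]

/-- **Lemma 4.1 along every good line, in terms of `ω`**: for `m ≤ M` there is `B ≥ 0` with
`‖(∂/∂s)^m Ĝ(k[l ↦ s])‖ ≤ B ω(k[l ↦ s])^{-(2+m)}` for all good lines and all `s` (on the cube
minus the origin this is `IsLaceCoefficientPc.exists_norm_sliceDeriv_le`; here for all `k`, as the
finite-difference estimates of the sequel need translates leaving the cube).
[cite: Hara2008, Lemma 4.1 ((4.6)–(4.7))] -/
theorem exists_norm_iteratedDeriv_twoPointSlice_le (h : IsLaceCoefficientPc d Φ) (hM2 : 2 ≤ M)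
    (hmom : Summable fun x => (1 + euclidNorm x) ^ M * |Φ x|) {m : ℕ} (hm : m ≤ M) :
    ∃ B : ℝ, 0 ≤ B ∧ ∀ (k : Fin d → ℝ) (l : Fin d), GoodLine k l → ∀ s : ℝ,
      ‖iteratedDeriv m (twoPointSlice Φ k l) s‖ ≤ B * omega (Function.update k l s) ^ (-(2 + (m : ℝ))) := by
  obtain ⟨c, C, -, -, hSl⟩ := sliceHyp_kspaceTwoPoint h hM2 hmom
  obtain ⟨B, hB0, hB⟩ := SliceHyp.exists_norm_iteratedDeriv_sliceG_le M 1 c C m hm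
  refine ⟨B * Rnorm d ^ (2 + (m : ℝ)), mul_nonneg hB0 (Real.rpow_nonneg (Rnorm_pos d).le _), fun k l hkl s => ?_⟩
  have hkey := hB _ _ _ (hSl k l hkl) s
  rw [← twoPointSlice_eq_sliceG h.summable_abs] at hkey
  refine hkey.trans (le_of_eq ?_)
  unfold rline
  rw [mul_one, div_Rnorm_rpow_neg _ _ (omega_nonneg _)]
  ring

/-- **Increments below the top order, uniformly in the line**: for `m < M` there is `B ≥ 0` with
`‖(∂/∂s)^m Ĝ(k[l ↦ s+u]) - (∂/∂s)^m Ĝ(k[l ↦ s])‖ ≤ B u ω₀^{-(3+m)}` whenever `ω ≥ ω₀ > 0` along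
`[s, s+u]` on a good line (mean value and Lemma 4.1 at order `m+1`).
[cite: Hara2008, Lemma 4.1 (used through the mean value theorem)] -/
theorem exists_norm_incr_twoPointSlice_le (h : IsLaceCoefficientPc d Φ) (hM2 : 2 ≤ M)
    (hmom : Summable fun x => (1 + euclidNorm x) ^ M * |Φ x|) {m : ℕ} (hm : m < M) :
    ∃ B : ℝ, 0 ≤ B ∧ ∀ (k : Fin d → ℝ) (l : Fin d), GoodLine k l → ∀ (s u ω₀ : ℝ), 0 ≤ u → 0 < ω₀ →
      (∀ t ∈ Icc s (s + u), ω₀ ≤ omega (Function.update k l t)) →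
      ‖iteratedDeriv m (twoPointSlice Φ k l) (s + u) - iteratedDeriv m (twoPointSlice Φ k l) s‖ ≤
        B * u * ω₀ ^ (-(3 + (m : ℝ))) := by
  obtain ⟨c, C, -, -, hSl⟩ := sliceHyp_kspaceTwoPoint h hM2 hmom
  obtain ⟨B, hB0, hB⟩ := SliceHyp.exists_norm_incr_sliceG_le M 1 c C hm
  refine ⟨B * Rnorm d ^ (3 + (m : ℝ)), mul_nonneg hB0 (Real.rpow_nonneg (Rnorm_pos d).le _), ?_⟩
  intro k l hkl s u ω₀ hu hω₀ hseg
  have hseg' : ∀ t ∈ Icc s (s + u), ω₀ / Rnorm d ≤ rline k l t := fun t ht =>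
    div_le_div_of_nonneg_right (hseg t ht) (Rnorm_pos d).le
  have hkey := hB _ _ _ (hSl k l hkl) s u (ω₀ / Rnorm d) hu (div_pos hω₀ (Rnorm_pos d)) hseg'
  rw [← twoPointSlice_eq_sliceG h.summable_abs] at hkey
  refine hkey.trans (le_of_eq ?_)
  rw [show -(2 + ((m : ℝ) + 1) * 1) = -(3 + (m : ℝ)) by ring, div_Rnorm_rpow_neg _ _ hω₀.le]
  ring

/-- **The top-order increment, uniformly in the line** (the input for `Ḡ^{(α)}`,
`⌊φ⌋ < α ≤ φ`): under the additional real moment `Σ_x |x|^{M+θ} |Π(x)| < ∞` (`0 ≤ θ ≤ 1`) there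
is `B ≥ 0` with `‖(∂/∂s)^M Ĝ(k[l ↦ s+u]) - (∂/∂s)^M Ĝ(k[l ↦ s])‖ ≤
B (u^θ ω₀^{-(2+M)} + u ω₀^{-(3+M)})` for `0 ≤ u ≤ 1` whenever `ω₀ ≤ ω ≤ 3ω₀` along `[s, s+u]`
on a good line. [cite: Hara2008, §4.1.4 (Ḡ^{(α)} for α > ⌊φ⌋; here via increments)] -/
theorem exists_norm_incr_twoPointSlice_top_le (h : IsLaceCoefficientPc d Φ) (hM2 : 2 ≤ M)
    (hmom : Summable fun x => (1 + euclidNorm x) ^ M * |Φ x|) {θ : ℝ} (hθ0 : 0 ≤ θ) (hθ1 : θ ≤ 1)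
    (hmomθ : Summable fun x => euclidNorm x ^ ((M : ℝ) + θ) * |Φ x|) :
    ∃ B : ℝ, 0 ≤ B ∧ ∀ (k : Fin d → ℝ) (l : Fin d), GoodLine k l → ∀ (s u ω₀ : ℝ), 0 ≤ u → u ≤ 1 → 0 < ω₀ →
      (∀ t ∈ Icc s (s + u), ω₀ ≤ omega (Function.update k l t) ∧ omega (Function.update k l t) ≤ 3 * ω₀) →
      ‖iteratedDeriv M (twoPointSlice Φ k l) (s + u) - iteratedDeriv M (twoPointSlice Φ k l) s‖ ≤
        B * (u ^ θ * ω₀ ^ (-(2 + (M : ℝ))) + u * ω₀ ^ (-(3 + (M : ℝ)))) := by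
  obtain ⟨c, C, -, -, hSl⟩ := sliceHyp_kspaceTwoPoint h hM2 hmom
  -- the Hölder constant of `φ_g^{(M)}`, uniform in the line
  have hg : Summable fun x => (1 + euclidNorm x) ^ M * |laceSource Φ x| := summable_moment_laceSource hmom
  have hMθpos : 0 < (M : ℝ) + θ := by
    have : (2 : ℝ) ≤ M := by exact_mod_cast hM2
    linarith
  have hgθ : Summable fun x => euclidNorm x ^ ((M : ℝ) + θ) * |laceSource Φ x| :=
    summable_rpow_mul_abs_laceSource hMθpos hmomθ
  set CH : ℝ := 2 * ∑' x, euclidNorm x ^ ((M : ℝ) + θ) * |laceSource Φ x| with hCH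
  have hCH0 : 0 ≤ CH := mul_nonneg zero_le_two (tsum_nonneg fun x =>
    mul_nonneg (Real.rpow_nonneg (euclidNorm_nonneg x) _) (abs_nonneg _))
  have hHolder : ∀ (k : Fin d → ℝ) (l : Fin d) (s u : ℝ), 0 ≤ u → u ≤ 1 →
      ‖iteratedDeriv M (sourceSlice Φ k l) (s + u) - iteratedDeriv M (sourceSlice Φ k l) s‖ ≤ CH * u ^ θ := by
    intro k l s u hu _
    have hl : Summable fun x => |((x l : ℤ) : ℝ)| ^ ((M : ℝ) + θ) * |laceSource Φ x| :=
      summable_abs_apply_rpow_mul_abs l hMθpos.le hgθ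
    unfold sourceSlice
    rw [iteratedDeriv_latticeFT_update hg k l M le_rfl]
    calc ‖latticeFTDn (laceSource Φ) l M (Function.update k l (s + u)) -
          latticeFTDn (laceSource Φ) l M (Function.update k l s)‖
        ≤ 2 * |u| ^ θ * ∑' x, |((x l : ℤ) : ℝ)| ^ ((M : ℝ) + θ) * |laceSource Φ x| :=
          norm_latticeFTDn_update_sub_le l hθ0 hθ1 (summable_abs_coordPow hg l le_rfl) hl k s u
      _ ≤ 2 * |u| ^ θ * ∑' x, euclidNorm x ^ ((M : ℝ) + θ) * |laceSource Φ x| := by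
          refine mul_le_mul_of_nonneg_left ?_ (mul_nonneg zero_le_two (Real.rpow_nonneg (abs_nonneg u) θ))
          exact Summable.tsum_le_tsum (fun x => mul_le_mul_of_nonneg_right (abs_apply_rpow_le x l hMθpos.le)
            (abs_nonneg _)) hl hgθ
      _ = CH * u ^ θ := by rw [hCH, abs_of_nonneg hu]; ring
  obtain ⟨B, hB0, hB⟩ := SliceHyp.exists_norm_incr_sliceG_top_le M 1 c C θ CH (by omega)
    (by linarith [(show (2 : ℝ) ≤ M by exact_mod_cast hM2)]) hθ1 hCH0
  refine ⟨B * Rnorm d ^ (3 + (M : ℝ)), mul_nonneg hB0 (Real.rpow_nonneg (Rnorm_pos d).le _), ?_⟩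
  intro k l hkl s u ω₀ hu hu1 hω₀ hseg
  have hR := Rnorm_pos d
  have hR1 := one_le_Rnorm d
  have hseg' : ∀ t ∈ Icc s (s + u), ω₀ / Rnorm d ≤ rline k l t ∧ rline k l t ≤ 3 * (ω₀ / Rnorm d) := by
    intro t ht
    refine ⟨div_le_div_of_nonneg_right (hseg t ht).1 hR.le, ?_⟩
    rw [rline, mul_div_assoc']
    exact div_le_div_of_nonneg_right (hseg t ht).2 hR.le
  have hkey := hB _ _ _ (hSl k l hkl) (hHolder k l) s u (ω₀ / Rnorm d) hu hu1 (div_pos hω₀ hR) hseg'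
  rw [← twoPointSlice_eq_sliceG h.summable_abs] at hkey
  refine hkey.trans ?_
  rw [mul_one, show -(2 + ((M : ℝ) + 1) * 1) = -(3 + (M : ℝ)) by ring, div_Rnorm_rpow_neg _ _ hω₀.le,
    div_Rnorm_rpow_neg _ _ hω₀.le]
  -- `R^{2+M} ≤ R^{3+M}`
  have hRpow : Rnorm d ^ (2 + (M : ℝ)) ≤ Rnorm d ^ (3 + (M : ℝ)) :=
    Real.rpow_le_rpow_of_exponent_le hR1 (by linarith)
  have h1 : 0 ≤ u ^ θ * ω₀ ^ (-(2 + (M : ℝ))) := mul_nonneg (Real.rpow_nonneg hu θ) (Real.rpow_nonneg hω₀.le _)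
  have h2 : 0 ≤ u * ω₀ ^ (-(3 + (M : ℝ))) := mul_nonneg hu (Real.rpow_nonneg hω₀.le _)
  calc B * (u ^ θ * (Rnorm d ^ (2 + (M : ℝ)) * ω₀ ^ (-(2 + (M : ℝ)))) +
        u * (Rnorm d ^ (3 + (M : ℝ)) * ω₀ ^ (-(3 + (M : ℝ)))))
      = B * Rnorm d ^ (2 + (M : ℝ)) * (u ^ θ * ω₀ ^ (-(2 + (M : ℝ)))) +
          B * Rnorm d ^ (3 + (M : ℝ)) * (u * ω₀ ^ (-(3 + (M : ℝ)))) := by ring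
    _ ≤ B * Rnorm d ^ (3 + (M : ℝ)) * (u ^ θ * ω₀ ^ (-(2 + (M : ℝ)))) +
          B * Rnorm d ^ (3 + (M : ℝ)) * (u * ω₀ ^ (-(3 + (M : ℝ)))) := by gcongr
    _ = B * Rnorm d ^ (3 + (M : ℝ)) * (u ^ θ * ω₀ ^ (-(2 + (M : ℝ))) + u * ω₀ ^ (-(3 + (M : ℝ)))) := by ring

end Consequences

end Literature.Barriers.CriticalPhenomena.HaraNorms
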